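import Summits.QuantumFields.BalabanUV.T4Continuum.Support.KroneckerLift
import Summits.QuantumFields.BalabanUV.T4Continuum.Support.BlockPairingGeometry

/-!
# T⁴ programme, spine node NE2 (U1a) — SITE-WISE COLOUR MULTIPLICATION OPERATORS `siteMul w` and their algebra against the lifted
# lattice operators `X ⊗ 1` (tier B, row B1.b of `t4/SKELETON-NE2-P1.md`)

Ninth generation of the NE2 prover lineage P1 of the cell `pub-balaban`, file 17 (on top of file 16 `KroneckerLift` and gen-9 file 5
`BlockPairingGeometry`).  A non-abelian background enters the covariant lattice operators through SITE-WISE COLOUR MATRICES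
`w x ∈ M_o(ℂ)` (transporters `R_ν(x)`, connections `c(R − 1)`, their products): the operator `siteMul w` on `(sites × components) ×
colours` with entries `[i = j]·w i k l`.  This file is the dictionary that turns every tier-A (`Matrix.diagonal`) identity into its
tier-B twin:

 * §1 `siteMul` (= `blockDiagonal` re-indexed site-first), entries, linearity, products, adjoints, and **`opNorm_siteMul_le`**
   (`‖siteMul w‖ ≤ sup ‖w i‖`, from the tree's `opNorm_blockDiagonal_le` + `opNorm_reindex`);
 * §2 the two ENTRY FORMULAS `(X ⊗ 1)·siteMul w` ↦ `X i j · w j k l`, `siteMul w′·(X ⊗ 1)` ↦ `w′ i k l · X i j` (X rectangular) and the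
   **INTERTWINING CRITERION** `kron_mul_siteMul_eq`: if `w′ i = w j` whenever `X i j ≠ 0` then `(X ⊗ 1)·siteMul w = siteMul w′·(X ⊗ 1)`
   — ONE lemma giving the shift (`w′ = w ∘ τ_μ`), King's pairing (`w′ = w ∘ parT`) and every diagonal `X` (`w′ = w`);
 * §3 consequences: **`kronShift_mul_siteMul`**, the DISCRETE LEIBNIZ RULE **`kronFdiff_mul_siteMul`**
   `(∇^c_μ ⊗ 1)·siteMul w = siteMul (w ∘ τ_μ)·(∇^c_μ ⊗ 1) + c·(siteMul (w ∘ τ_μ) − siteMul w)`, **`kronJK_mul_siteMul`**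
   `(J ⊗ 1)·siteMul w = siteMul (w ∘ parT)·(J ⊗ 1)`, and unitary conjugation **`conj_siteMul_of_intertwine`**.

HONEST FRAMING (T4-DAG p. 1).  Pure finite-dimensional linear algebra; no estimate of the programme is touched; rates / constants OURS;
NOT infinite volume / mass gap / Clay / summit progress; spine 0/9 unchanged.  HONEST DEPENDENCY: continuum YM on T⁴ ⇐ BetaPertH ∧ nine
spine estimates (0/9 proved); BetaPertH ⇐ (D1) ∧ (D4) ∧ CAP+tail; G-an2-4 gates asym, D1 and NE2/3/4.  ABSOLUTE RULE kept; no `sorry`.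
-/

noncomputable section

open scoped BigOperators ComplexConjugate Matrix Matrix.Norms.L2Operator Kronecker

namespace Summit.QuantumFields.BalabanUV.T4Continuum.BlockMultiplication

open Literature.MathematicalPhysics.QuantumFieldTheory.Balaban1983to89.B5Prop11Plancherel (opNorm_blockDiagonal_le opNorm_reindex
  shiftM fdiff fine Tor unitVec)
open Summit.QuantumFields.BalabanUV.T4Continuum.KingPairingPlantedLaw (JK)
open Summit.QuantumFields.BalabanUV.T4Continuum.BlockPairingGeometry (tau parT JK_apply)
open Summit.QuantumFields.BalabanUV.T4Continuum.KroneckerLift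

/-! ## §1 Site-wise colour multiplication operators -/

section SiteMul

variable {ι ι' o : Type*}

/-- **site-wise colour multiplication**: `(siteMul w f)(i, k) = Σ_l w i k l · f(i, l)`. [folklore] -/
def siteMul [DecidableEq ι] (w : ι → Matrix o o ℂ) : Matrix (ι × o) (ι × o) ℂ :=
  Matrix.reindex (Equiv.prodComm o ι) (Equiv.prodComm o ι) (Matrix.blockDiagonal w)

/-- entries. [folklore] -/
theorem siteMul_apply [DecidableEq ι] (w : ι → Matrix o o ℂ) (a b : ι × o) : siteMul w a b = if a.1 = b.1 then w a.1 a.2 b.2 else 0 := by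
  simp only [siteMul, Matrix.reindex_apply, Matrix.submatrix_apply, Equiv.prodComm_symm, Equiv.prodComm_apply, Prod.swap,
    Matrix.blockDiagonal_apply']

/-- additivity. [folklore] -/
theorem siteMul_add [DecidableEq ι] (v w : ι → Matrix o o ℂ) : siteMul (fun i => v i + w i) = siteMul v + siteMul w := by
  ext a b; simp only [siteMul_apply, Matrix.add_apply]; split_ifs <;> simp

/-- subtraction. [folklore] -/
theorem siteMul_sub [DecidableEq ι] (v w : ι → Matrix o o ℂ) : siteMul (fun i => v i - w i) = siteMul v - siteMul w := by
  ext a b; simp only [siteMul_apply, Matrix.sub_apply]; split_ifs <;> simp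

/-- scalars. [folklore] -/
theorem siteMul_smul [DecidableEq ι] (c : ℂ) (w : ι → Matrix o o ℂ) : siteMul (fun i => c • w i) = c • siteMul w := by
  ext a b; simp only [siteMul_apply, Matrix.smul_apply, smul_eq_mul]; split_ifs <;> simp

/-- negation. [folklore] -/
theorem siteMul_neg [DecidableEq ι] (w : ι → Matrix o o ℂ) : siteMul (fun i => -w i) = -siteMul w := by
  ext a b; simp only [siteMul_apply, Matrix.neg_apply]; split_ifs <;> simp

/-- adjoint: `(siteMul w)ᴴ = siteMul (wᴴ)`. [folklore] -/
theorem siteMul_conjTranspose [DecidableEq ι] (w : ι → Matrix o o ℂ) : (siteMul w)ᴴ = siteMul fun i => (w i)ᴴ := by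
  ext a b
  simp only [Matrix.conjTranspose_apply, siteMul_apply]
  by_cases h : a.1 = b.1
  · rw [if_pos h, if_pos h.symm, h]
  · rw [if_neg h, if_neg (Ne.symm h), star_zero]

/-- products: `siteMul v · siteMul w = siteMul (v·w)`. [folklore] -/
theorem siteMul_mul [Fintype ι] [Fintype o] [DecidableEq ι] (v w : ι → Matrix o o ℂ) : siteMul v * siteMul w = siteMul fun i => v i * w i := by
  ext a b
  rw [Matrix.mul_apply, siteMul_apply, Fintype.sum_prod_type]
  simp only [siteMul_apply]
  rw [Finset.sum_eq_single a.1]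
  · by_cases h : a.1 = b.1
    · simp [h, Matrix.mul_apply]
    · simp [h]
  · intro j _ hj; simp [Ne.symm hj]
  · intro h; exact absurd (Finset.mem_univ _) h

/-- the constant family `1` gives the identity. [folklore] -/
theorem siteMul_one [DecidableEq ι] [DecidableEq o] : siteMul (fun _ : ι => (1 : Matrix o o ℂ)) = 1 := by
  ext a b
  rw [siteMul_apply, Matrix.one_apply, Matrix.one_apply]
  by_cases h : a = b
  · subst h; simp
  · by_cases h1 : a.1 = b.1
    · have h2 : a.2 ≠ b.2 := fun h2 => h (Prod.ext h1 h2)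
      simp [h1, h2, h]
    · simp [h1, h]

/-- **`‖siteMul w‖ ≤ α`** whenever every colour matrix has `‖w i‖ ≤ α`. [folklore] -/
theorem opNorm_siteMul_le [Fintype ι] [Fintype o] [DecidableEq ι] [DecidableEq o] (w : ι → Matrix o o ℂ) {α : ℝ} (hα : 0 ≤ α) (hw : ∀ i, ‖w i‖ ≤ α) : ‖siteMul w‖ ≤ α := by
  rw [siteMul, opNorm_reindex]
  exact opNorm_blockDiagonal_le w hα hw

/-! ## §2 Entry formulas against lifted operators and the intertwining criterion -/

/-- `((X ⊗ 1)·siteMul w)(a, b) = X a.1 b.1 · w b.1 a.2 b.2`. [folklore] -/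
theorem kron_mul_siteMul_apply [Fintype ι'] [Fintype o] [DecidableEq ι'] [DecidableEq o] (X : Matrix ι ι' ℂ) (w : ι' → Matrix o o ℂ) (a : ι × o) (b : ι' × o) :
    (X ⊗ₖ (1 : Matrix o o ℂ) * siteMul w) a b = X a.1 b.1 * w b.1 a.2 b.2 := by
  rw [Matrix.mul_apply, Fintype.sum_prod_type, Finset.sum_eq_single b.1]
  · rw [Finset.sum_eq_single a.2]
    · simp [siteMul_apply]
    · intro l _ hl; simp [Ne.symm hl]
    · intro h; exact absurd (Finset.mem_univ _) h
  · intro j _ hj; simp [siteMul_apply, hj]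
  · intro h; exact absurd (Finset.mem_univ _) h

/-- `(siteMul w′·(X ⊗ 1))(a, b) = w′ a.1 a.2 b.2 · X a.1 b.1`. [folklore] -/
theorem siteMul_mul_kron_apply [Fintype ι] [Fintype o] [DecidableEq ι] [DecidableEq o] (w' : ι → Matrix o o ℂ) (X : Matrix ι ι' ℂ) (a : ι × o) (b : ι' × o) :
    (siteMul w' * X ⊗ₖ (1 : Matrix o o ℂ)) a b = w' a.1 a.2 b.2 * X a.1 b.1 := by
  rw [Matrix.mul_apply, Fintype.sum_prod_type, Finset.sum_eq_single a.1]
  · rw [Finset.sum_eq_single b.2]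
    · simp [siteMul_apply]
    · intro l _ hl; simp [hl]
    · intro h; exact absurd (Finset.mem_univ _) h
  · intro j _ hj; simp [siteMul_apply, Ne.symm hj]
  · intro h; exact absurd (Finset.mem_univ _) h

/-- **THE INTERTWINING CRITERION**: if `w′ i = w j` whenever `X i j ≠ 0`, then `(X ⊗ 1)·siteMul w = siteMul w′·(X ⊗ 1)`. [folklore] -/
theorem kron_mul_siteMul_eq [Fintype ι] [Fintype ι'] [Fintype o] [DecidableEq ι] [DecidableEq ι'] [DecidableEq o] {X : Matrix ι ι' ℂ} {w : ι' → Matrix o o ℂ} {w' : ι → Matrix o o ℂ}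
    (h : ∀ i j, X i j ≠ 0 → w' i = w j) : X ⊗ₖ (1 : Matrix o o ℂ) * siteMul w = siteMul w' * X ⊗ₖ (1 : Matrix o o ℂ) := by
  classical
  ext a b
  rw [kron_mul_siteMul_apply, siteMul_mul_kron_apply]
  by_cases hX : X a.1 b.1 = 0
  · rw [hX, zero_mul, mul_zero]
  · rw [h a.1 b.1 hX, mul_comm]

/-- unitary conjugation through an intertwiner: `XᴴX = 1` and the criterion give `(X ⊗ 1)ᴴ·siteMul w′·(X ⊗ 1) = siteMul w`.
[folklore] -/
theorem conj_siteMul_of_intertwine [Fintype ι] [Fintype ι'] [Fintype o] [DecidableEq ι] [DecidableEq ι']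
    [DecidableEq o] {X : Matrix ι ι' ℂ} {w : ι' → Matrix o o ℂ} {w' : ι → Matrix o o ℂ}
    (h : ∀ i j, X i j ≠ 0 → w' i = w j) (hX : Xᴴ * X = 1) :
    (X ⊗ₖ (1 : Matrix o o ℂ))ᴴ * siteMul w' * X ⊗ₖ (1 : Matrix o o ℂ) = siteMul w := by
  classical
  rw [Matrix.mul_assoc, ← kron_mul_siteMul_eq h, ← Matrix.mul_assoc, kron_conjTranspose, ← kron_mul, hX,
    Matrix.one_kronecker_one, Matrix.one_mul]

end SiteMul

/-! ## §3 Against the lattice operators: shift, difference (Leibniz), King's pairing -/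

section Lattice

variable {d : ℕ} (Nf : Fin d → ℕ) [hNf : ∀ μ, NeZero (Nf μ)] {o : Type*} [Fintype o] [DecidableEq o]

/-- **`(S_μ ⊗ 1)·siteMul w = siteMul (w ∘ τ_μ)·(S_μ ⊗ 1)`**. [folklore] -/
theorem kronShift_mul_siteMul (μ : Fin d) (w : Tor Nf × Fin d → Matrix o o ℂ) :
    shiftM Nf μ ⊗ₖ (1 : Matrix o o ℂ) * siteMul w = siteMul (w ∘ tau Nf μ) * shiftM Nf μ ⊗ₖ (1 : Matrix o o ℂ) := by
  refine kron_mul_siteMul_eq fun i j hij => ?_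
  have hj : j = (i.1 + unitVec Nf μ, i.2) := by
    by_contra hne; exact hij (by simp [shiftM, hne])
  subst hj; rfl

/-- **THE DISCRETE LEIBNIZ RULE, colour version**:
`(∇^c_μ ⊗ 1)·siteMul w = siteMul (w ∘ τ_μ)·(∇^c_μ ⊗ 1) + c·(siteMul (w ∘ τ_μ) − siteMul w)`. [cite: Balaban1984PropagatorsI, (1.31) p.23]
[folklore] -/
theorem kronFdiff_mul_siteMul (c : ℂ) (μ : Fin d) (w : Tor Nf × Fin d → Matrix o o ℂ) :
    fdiff Nf c μ ⊗ₖ (1 : Matrix o o ℂ) * siteMul w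
      = siteMul (w ∘ tau Nf μ) * fdiff Nf c μ ⊗ₖ (1 : Matrix o o ℂ) + c • (siteMul (w ∘ tau Nf μ) - siteMul w) := by
  have e : fdiff Nf c μ ⊗ₖ (1 : Matrix o o ℂ) = c • (shiftM Nf μ ⊗ₖ (1 : Matrix o o ℂ) - 1) := by
    rw [fdiff, Matrix.smul_kronecker, sub_kronecker, Matrix.one_kronecker_one]
  rw [e, Matrix.smul_mul, Matrix.sub_mul, Matrix.one_mul, kronShift_mul_siteMul, Matrix.mul_smul, Matrix.mul_sub, Matrix.mul_one]
  simp only [smul_sub]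
  abel

/-- `(S_μ ⊗ 1)ᴴ·siteMul (w ∘ τ_μ)·(S_μ ⊗ 1) = siteMul w`. [folklore] -/
theorem conjKronShift_siteMul (μ : Fin d) (w : Tor Nf × Fin d → Matrix o o ℂ) :
    (shiftM Nf μ ⊗ₖ (1 : Matrix o o ℂ))ᴴ * siteMul (w ∘ tau Nf μ) * shiftM Nf μ ⊗ₖ (1 : Matrix o o ℂ) = siteMul w := by
  refine conj_siteMul_of_intertwine (fun i j hij => ?_) (BlockPairingGeometry.conjTranspose_shiftM_mul Nf μ)
  have hj : j = (i.1 + unitVec Nf μ, i.2) := by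
    by_contra hne; exact hij (by simp [shiftM, hne])
  subst hj; rfl

end Lattice

section Pairing

variable {d : ℕ} (N R : ℕ) [NeZero N] [NeZero R] (M : Fin d → ℕ) [hM : ∀ μ, NeZero (M μ)] {o : Type*} [Fintype o] [DecidableEq o]

/-- **KING'S PAIRING THROUGH COLOUR MULTIPLICATIONS**: `(J_R ⊗ 1)·siteMul w = siteMul (w ∘ parT)·(J_R ⊗ 1)`. [cite: King1986, (2.10)
p.653] [folklore] -/
theorem kronJK_mul_siteMul (w : Tor (fine N M) × Fin d → Matrix o o ℂ) :
    JK N R M ⊗ₖ (1 : Matrix o o ℂ) * siteMul w = siteMul (w ∘ parT N R M) * JK N R M ⊗ₖ (1 : Matrix o o ℂ) := by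
  refine kron_mul_siteMul_eq fun x y hxy => ?_
  have hy : parT N R M x = y := by
    by_contra hne
    exact hxy (by rw [JK_apply, if_neg hne, mul_zero, mul_zero])
  subst hy; rfl

end Pairing

end Summit.QuantumFields.BalabanUV.T4Continuum.BlockMultiplication

end
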